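import Summits.FinalStateConjecture.FinalStateConjecture.Theorems.StarvedNecksHonestFixedRadiusSettlingCert
import Summits.FinalStateConjecture.FinalStateConjecture.Theorems.WeakCosmicCensorshipMGHD.Negative.ConstraintsLoadBearing
import Summits.FinalStateConjecture.FinalStateConjecture.Theorems.WeakCosmicCensorshipMGHD.Negative.CompleteRedundant
import Summits.FinalStateConjecture.FinalStateConjecture.Theorems.WeakCosmicCensorshipMGHD.Negative.SecondCountableRedundant

/-!
# Crux `StarvedNecks.HonestFixedRadiusSettling` (stmt-FinalStateConjecture-13550) — negative side,
# generation 3, part I: the live leaf `stub_core` read back; one atlas certifies `𝓘⁺`; the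
# load-bearing table of the ADMISSIBILITY clauses for the crux and for the leaf

The picked line `sojourn-needs-only-one-over-delta` has reduced the crux to ONE registered stub,
`stub_core : KerrEndedHonestSettlingGeneric` (skeleton `Cruxes/HonestFixedRadiusSettling/Lines/
sojourn_needs_only_one_over_delta.lean`, reshape v2), through the landed reduction
`StarvedNecks.OneOverDelta.honestFixedRadiusSettling_of_core` and the certificate
`StarvedNecks.OneOverDelta.hasCompleteNullInfinity_of_oneAtlas` (CERT). This file is the disprover's
read-back of that leaf and the load-bearing analysis of the hypotheses the crux and the leaf take
from the admissible class, kernel-checked (`sorry`-free, no named facts):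

* §1 READ-BACK. `oneAtlasDecompositions 𝒟 O k` — the decompositions admitting the seventeen ONE-ATLAS
  clauses (verbatim the def-free hypotheses of CERT: compact core, `κ > 0`, Kerr end `0 ≤ M`,
  `|a| ≤ M`, continuous inner profile `R♯ ≥ 16M + |a| + 1` of slope `≤ 2`, ZONE, EXACT, ORIENTED,
  INJECTIVE, ATTACHED ×4, COVER, SEPARATED); `oneAtlasHonestDevelopments D`; `coreSet X` (the property
  `Q` of `stub_core` as a set of data). `not_coreGeneric_of_not_crux` is proved by `exact`ing the landed
  reduction, so `· ∈ coreSet X` IS the registered stub's property up to unfolding, and ANY REFUTATION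
  OF THE CRUX REFUTES THE LEAF; `coreSet X ⊆ settlingSet X` (`Q ⇒ P` pointwise, by CERT);
  `core_codim_zero` (codimension `0` is free for `Q` as for `P`: the `1` is the content).
* §2 ONE ATLAS CERTIFIES `𝓘⁺`, negatively: a development with INCOMPLETE future null infinity carries
  no `Cᵏ` (`k ≥ 1`) decomposition with one atlas at infinity, of any region
  (`not_mem_oneAtlasDecompositions_of_not_hasCompleteNullInfinity`) — the seventeen clauses are
  genuinely restrictive; part II (`OneAtlasMaximality.lean`) instantiates this at the time-truncated
  Minkowski development to show that the leaf's maximality guard is load-bearing.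
* §3 THE VACUUM-CONSTRAINT CLAUSE IS LOAD-BEARING, for the crux AND for the leaf: with
  `D.IsVacuumConstraintSolution` deleted from the admissible class (`admissibleNoConstraint`, of the
  sibling crux `WeakCosmicCensorshipMGHD`'s negative battery) both generic statements are FALSE
  (`crux_false_without_constraints`, `core_false_without_constraints`): they imply the constraint-free
  weak-cosmic-censorship statement refuted there by the trapped bump datum
  (`wcc_false_without_constraints`).
* §4 THE COMPLETENESS CLAUSE IS REDUNDANT for both (`admissibleVacuumData_eq_of_t2`: a sole strongly
  asymptotically flat end forces completeness): `cruxWithoutComplete_of_crux`,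
  `not_cruxWithoutComplete_of_not_crux`, and the same for the leaf.
* §5 `[SecondCountableTopology Σ]` IS REDUNDANT for both (an admissible datum carries a sole end, which
  makes `Σ` second countable): `cruxWithoutSecondCountable_of_crux`, `coreWithoutSecondCountable_of_core`.

With the codimension (`KillShape.codim_zero`), the maximality guard (`MaximalityLoadBearing`, part II)
and the WCC content (`KillShape.crux_false_of_not_wcc`) this completes the load-bearing table of every
hypothesis the crux and its live leaf carry. Nothing here is a refutation: `stub_core` is the
open-problem core. References: Christodoulou, CQG 16 (1999) A23, p. A24 (genericity, admissible
class); Choquet-Bruhat 2009, Ch. VI, Thm. 3.3 (constraints); Gordon, PAMS 37 (1973) (completeness).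
-/

noncomputable section

set_option linter.dupNamespace false

open Literature.Geometry.Lorentzian
open scoped Manifold ContDiff ENNReal Topology
open Filter Set TopologicalSpace Topology

namespace Summit.FinalStateConjecture.FinalStateConjecture.Theorems.HonestFixedRadiusSettling.Negative

open Summit.FinalStateConjecture.FinalStateConjecture.Theses.StarvedNecks (HonestFixedRadiusSettling)
open Summit.FinalStateConjecture.FinalStateConjecture.Theorems.StarvedNecks.OneOverDelta
  (hasCompleteNullInfinity_of_oneAtlas honestFixedRadiusSettling_of_core)
open Summit.FinalStateConjecture.FinalStateConjecture.Theorems.WeakCosmicCensorshipMGHD.Negative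
  (admissibleNoConstraint wcc_false_without_constraints admissibleVacuumData_eq_of_t2
    secondCountableTopology_of_mem_admissibleVacuumData)

/-! ### §1 Read-back of the live leaf `stub_core` -/

section OneAtlas

variable {X : Type} [TopologicalSpace X] [ChartedSpace E3 X] [IsManifold (𝓡 3) ∞ X] [ConnectedSpace X]
  {D : InitialDataSet (𝓡 3) X}

/-- The `Cᵏ` final-state decompositions `d` of the region `O` of a vacuum Cauchy development `𝒟`
which admit ONE ATLAS AT INFINITY for some Kerr end `(M, a)` attached along some `φ`, inner profile
`R♯ = Rs`, core `Bs` and tube-separation rate `κ` — verbatim the seventeen def-free hypotheses of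
CERT (`hasCompleteNullInfinity_of_oneAtlas`) after its `1 ≤ k`, i.e. the skeleton's
`OneAtlasAtInfinity 𝒟 d M a r₁ φ Rs Bs κ` with `kerrBL`/`blToKS`/`blHeight` unfolded. -/
def oneAtlasDecompositions (𝒟 : VacuumCauchyDevelopment D) (O : Set 𝒟.carrier) (k : ℕ) :
    Set (FinalStateDecomposition 𝒟.toSpacetime O k) :=
  {d | let blH : ℝ → ℝ → ℝ → ℝ := fun M a r ↦
      Real.smoothTransition (r / (4 * M) - 1) *
        ((M / Real.sqrt (M ^ 2 - a ^ 2)) *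
            (Kerr.rPlus M a * Real.log (r - Kerr.rPlus M a) - Kerr.rMinus M a * Real.log (r - Kerr.rMinus M a)) -
          (M / Real.sqrt (M ^ 2 - a ^ 2)) *
            (Kerr.rPlus M a * Real.log (4 * M - Kerr.rPlus M a) -
              Kerr.rMinus M a * Real.log (4 * M - Kerr.rMinus M a)))
    let toKS : ℝ → ℝ → E4 → E4 := fun M a y ↦
      E4.ofTimeSpace (y 0 + blH M a (Kerr.radius a (E4.ofTimeSpace 0 (E4.spatial y)))) (E4.spatial y)
    let gBL : ℝ → ℝ → E4 → E4 →L[ℝ] E4 →L[ℝ] ℝ := fun M a y ↦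
      (Kerr.bilin M a (toKS M a y)).bilinearComp (fderiv ℝ (toKS M a) y) (fderiv ℝ (toKS M a) y)
    ∃ (M a r₁ : ℝ) (φ : Kerr.slice a r₁ → X) (Rs : ℝ → ℝ) (Bs : Set X) (κ : ℝ),
      IsCompact Bs ∧ 0 < κ ∧ 0 ≤ M ∧ |a| ≤ M ∧ Continuous Rs ∧ (∀ t, 16 * M + |a| + 1 ≤ Rs t) ∧
      (∀ t t' : ℝ, 0 ≤ t → t ≤ t' → Rs t' ≤ Rs t + 2 * (t' - t)) ∧
      ({y : E4 | -1 < y 0 ∧ Rs (y 0) < E4.spatialNorm y} ⊆ (d.flatDomain : Set E4)) ∧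
      (∀ y : d.flatDomain, -1 < y.1 0 → Rs (y.1 0) < E4.spatialNorm y.1 →
        𝒟.toSpacetime.deviation (Minkowski.backgroundOn d.flatDomain) d.flatChart y =
          gBL M a y.1 - Minkowski.bilin) ∧
      (∀ y : d.flatDomain, -1 < y.1 0 → Rs (y.1 0) < E4.spatialNorm y.1 →
        𝒟.timeOrientation.IsFutureDirected (mfderiv 𝓘(ℝ, E4) (𝓡 4) d.flatChart y (E4.basisVector 0))) ∧
      Set.InjOn d.flatChart {y : d.flatDomain | 0 ≤ y.1 0} ∧
      IsOpenEmbedding φ ∧ ContMDiff 𝓘(ℝ, E3) (𝓡 3) ∞ φ ∧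
      (∀ ρ : ℝ, IsCompact (φ '' {x : Kerr.slice a r₁ | ρ < ‖(x : E3)‖})ᶜ) ∧
      (∀ (x : Kerr.slice a r₁) (hx : E4.ofTimeSpace 0 (x : E3) ∈ d.flatDomain), Rs 0 < ‖(x : E3)‖ →
        d.flatChart ⟨E4.ofTimeSpace 0 (x : E3), hx⟩ = 𝒟.embed (φ x)) ∧
      (𝒟.metric.causalFuture 𝒟.timeOrientation (range 𝒟.embed) ⊆
        𝒟.metric.causalFuture 𝒟.timeOrientation (𝒟.embed '' Bs) ∪
          d.flatChart '' {y : d.flatDomain | 0 ≤ y.1 0 ∧ Rs (y.1 0) < E4.spatialNorm y.1}) ∧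
      (∀ (i : Fin d.N) (z : E4), d.τ₀ ≤ z 0 →
        Kerr.radius (d.spin i) (poincareInv (d.motion i).1 (d.motion i).2 z) ≤ d.excision i (z 0) →
          E4.spatialNorm z + κ * z 0 ≤ Rs (z 0))}

/-- The vacuum Cauchy developments of `D` carrying an honest `C⁴` fixed-radius decomposition of
their self-determined exterior (the crux's `Hc`/`Hf`, as `honestCoreSet`/`honestFarSet`) WITH ONE
ATLAS AT INFINITY — and no `𝓘⁺` clause: the universal conjunct of `stub_core`'s property `Q`. -/
def oneAtlasHonestDevelopments (D : InitialDataSet (𝓡 3) X) : Set (VacuumCauchyDevelopment D) :=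
  {𝒟 | ∃ (O : Set 𝒟.carrier) (d : FinalStateDecomposition 𝒟.toSpacetime O 4) (R₀ : ℝ),
    O = exteriorOf 𝒟.toCauchyDevelopment d.charted ∧
      d ∈ honestCoreSet 𝒟.toSpacetime O 4 R₀ ∧ d ∈ honestFarSet 𝒟.toSpacetime O 4 R₀ ∧
        d ∈ oneAtlasDecompositions 𝒟 O 4}

variable (X) in
/-- The property `Q` of `stub_core` as a set of data: an MGHD exists and every MGHD is an honest
one-atlas development. `stub_core` ≡ `∀ X, IsChristodoulouGeneric (admissibleVacuumData X) (· ∈ coreSet X) 1`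
(read-back check: `not_coreGeneric_of_not_crux`). -/
def coreSet : Set (InitialDataSet (𝓡 3) X) :=
  {D | (∃ 𝒟 : VacuumCauchyDevelopment D, 𝒟.IsMaximal) ∧
    ∀ 𝒟 : VacuumCauchyDevelopment D, 𝒟.IsMaximal → 𝒟 ∈ oneAtlasHonestDevelopments D}

variable (X) in
/-- `Q` with the guard `𝒟.IsMaximal →` DELETED from its universal conjunct: an MGHD exists and EVERY
vacuum Cauchy development is an honest one-atlas development. -/
def coreSetWithoutIsMaximal : Set (InitialDataSet (𝓡 3) X) :=
  {D | (∃ 𝒟 : VacuumCauchyDevelopment D, 𝒟.IsMaximal) ∧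
    ∀ 𝒟 : VacuumCauchyDevelopment D, 𝒟 ∈ oneAtlasHonestDevelopments D}

/-- The unguarded property is stronger than `Q`, pointwise. -/
theorem coreSetWithoutIsMaximal_subset_coreSet : coreSetWithoutIsMaximal X ⊆ coreSet X :=
  fun _ h ↦ ⟨h.1, fun 𝒟 _ ↦ h.2 𝒟⟩

/-- **CERT, read over the sets**: an honest one-atlas development (any `D`, any `X` with the crux's
instances) is an honest development in the sense of the crux — its `𝓘⁺` is complete by
`hasCompleteNullInfinity_of_oneAtlas` at `k = 4`. -/
theorem oneAtlasHonestDevelopments_subset_honestDevelopments [T2Space X] [SecondCountableTopology X]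
    (D : InitialDataSet (𝓡 3) X) : oneAtlasHonestDevelopments D ⊆ honestDevelopments D := by
  rintro 𝒟 ⟨O, d, R₀, hO, hc, hf, M, a, r₁, φ, Rs, Bs, κ, h1, h2, h3, h4, h5, h6, h7, h8, h9, h10, h11, h12,
    h13, h14, h15, h16, h17⟩
  exact ⟨hasCompleteNullInfinity_of_oneAtlas X D 𝒟 O 4 d M a r₁ φ Rs Bs κ (by norm_num) h1 h2 h3 h4 h5 h6
    h7 h8 h9 h10 h11 h12 h13 h14 h15 h16 h17, O, d, R₀, hO, hc, hf⟩

/-- `Q ⇒ P` pointwise: `coreSet X ⊆ settlingSet X`. -/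
theorem coreSet_subset_settlingSet [T2Space X] [SecondCountableTopology X] : coreSet X ⊆ settlingSet X :=
  fun D h ↦ ⟨h.1, fun 𝒟 h𝒟 ↦ oneAtlasHonestDevelopments_subset_honestDevelopments D (h.2 𝒟 h𝒟)⟩

end OneAtlas

/-- **READ-BACK CHECK and contrapositive of the line's reduction.** Any refutation of the crux
refutes `stub_core`: the generic statement over `coreSet` implies `HonestFixedRadiusSettling` by the
LANDED `honestFixedRadiusSettling_of_core`, applied verbatim — so `· ∈ coreSet X` is definitionally
the registered stub's property, and the live leaf is at least as strong as the crux. -/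
theorem not_coreGeneric_of_not_crux (hn : ¬ HonestFixedRadiusSettling) :
    ¬ ∀ (X : Type) [TopologicalSpace X] [ChartedSpace E3 X] [IsManifold (𝓡 3) ∞ X] [T2Space X]
      [SecondCountableTopology X] [ConnectedSpace X],
      InitialDataSet.IsChristodoulouGeneric (admissibleVacuumData X) (· ∈ coreSet X) 1 :=
  fun h ↦ hn (honestFixedRadiusSettling_of_core h)

/-- Codimension `0` is free for `Q` exactly as for `P` (constant families): the `1` is the content. -/
theorem core_codim_zero (X : Type) [TopologicalSpace X] [ChartedSpace E3 X] [IsManifold (𝓡 3) ∞ X]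
    [T2Space X] [SecondCountableTopology X] [ConnectedSpace X] :
    InitialDataSet.IsChristodoulouGeneric (admissibleVacuumData X) (· ∈ coreSet X) 0 :=
  isChristodoulouGeneric_zero _ _

/-! ### §2 One atlas certifies `𝓘⁺` (negatively) -/

section Cert

variable {X : Type} [TopologicalSpace X] [ChartedSpace E3 X] [IsManifold (𝓡 3) ∞ X] [T2Space X]
  [SecondCountableTopology X] [ConnectedSpace X] {D : InitialDataSet (𝓡 3) X}

/-- **A development with incomplete `𝓘⁺` carries no one atlas at infinity** (any region, any `Cᵏ`
decomposition with `k ≥ 1`): contrapositive of CERT. -/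
theorem not_mem_oneAtlasDecompositions_of_not_hasCompleteNullInfinity {𝒟 : VacuumCauchyDevelopment D}
    (h𝒟 : ¬ HasCompleteNullInfinity 𝒟.toCauchyDevelopment) (O : Set 𝒟.carrier) {k : ℕ} (hk : 1 ≤ k)
    (d : FinalStateDecomposition 𝒟.toSpacetime O k) : d ∉ oneAtlasDecompositions 𝒟 O k := by
  rintro ⟨M, a, r₁, φ, Rs, Bs, κ, h1, h2, h3, h4, h5, h6, h7, h8, h9, h10, h11, h12, h13, h14, h15, h16, h17⟩
  exact h𝒟 (hasCompleteNullInfinity_of_oneAtlas X D 𝒟 O k d M a r₁ φ Rs Bs κ hk h1 h2 h3 h4 h5 h6 h7 h8 h9 h10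
    h11 h12 h13 h14 h15 h16 h17)

/-- Hence such a development is not an honest one-atlas development. -/
theorem not_mem_oneAtlasHonestDevelopments_of_not_hasCompleteNullInfinity {𝒟 : VacuumCauchyDevelopment D}
    (h𝒟 : ¬ HasCompleteNullInfinity 𝒟.toCauchyDevelopment) : 𝒟 ∉ oneAtlasHonestDevelopments D := by
  rintro ⟨O, d, R₀, -, -, -, hd⟩
  exact not_mem_oneAtlasDecompositions_of_not_hasCompleteNullInfinity h𝒟 O (by norm_num) d hd

end Cert

/-! ### §3 The vacuum-constraint clause of admissibility is load-bearing (crux and leaf) -/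

/-- **Without the vacuum constraints the crux is FALSE.** The statement negated is
`HonestFixedRadiusSettling` with the admissible class replaced by `admissibleNoConstraint X`
(`D.IsVacuumConstraintSolution` deleted, everything else verbatim, the property written as
membership in `settlingSet`). It implies the constraint-free weak-cosmic-censorship statement
(genericity is monotone in the property, `P ⇒` censored), refuted by the trapped bump datum
`(ℝ³, δ, ψ(‖y‖²)δ)` in `wcc_false_without_constraints`. -/
theorem crux_false_without_constraints :
    ¬ ∀ (X : Type) [TopologicalSpace X] [ChartedSpace E3 X] [IsManifold (𝓡 3) ∞ X] [T2Space X]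
      [SecondCountableTopology X] [ConnectedSpace X],
      InitialDataSet.IsChristodoulouGeneric (admissibleNoConstraint X) (· ∈ settlingSet X) 1 :=
  fun h ↦ wcc_false_without_constraints fun X _ _ _ _ _ _ ↦
    isChristodoulouGeneric_mono (fun _ _ hD ↦ settlingSet_subset_censoredSet hD) (h X)

/-- **Without the vacuum constraints the leaf `stub_core` is FALSE** as well (`Q ⇒ P` pointwise). -/
theorem core_false_without_constraints :
    ¬ ∀ (X : Type) [TopologicalSpace X] [ChartedSpace E3 X] [IsManifold (𝓡 3) ∞ X] [T2Space X]
      [SecondCountableTopology X] [ConnectedSpace X],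
      InitialDataSet.IsChristodoulouGeneric (admissibleNoConstraint X) (· ∈ coreSet X) 1 :=
  fun h ↦ crux_false_without_constraints fun X _ _ _ _ _ _ ↦
    isChristodoulouGeneric_mono (fun _ _ hD ↦ coreSet_subset_settlingSet hD) (h X)

/-! ### §4 The completeness clause of admissibility is redundant (crux and leaf) -/

/-- The crux implies its version over the admissible class WITH THE COMPLETENESS CLAUSE DELETED
(the two classes coincide on Hausdorff second-countable `Σ`, `admissibleVacuumData_eq_of_t2`). -/
theorem cruxWithoutComplete_of_crux (h : HonestFixedRadiusSettling) (X : Type) [TopologicalSpace X]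
    [ChartedSpace E3 X] [IsManifold (𝓡 3) ∞ X] [T2Space X] [SecondCountableTopology X] [ConnectedSpace X] :
    InitialDataSet.IsChristodoulouGeneric
      {D : InitialDataSet (𝓡 3) X | (∀ [D.metric.HasLeviCivita], D.IsVacuumConstraintSolution) ∧
        ∃ (e : AFEnd X) (M : ℝ), e.IsSoleEnd ∧ e.IsStronglyAsymptoticallyFlatDR D M}
      (· ∈ settlingSet X) 1 := by
  rw [← admissibleVacuumData_eq_of_t2]
  exact crux_iff.1 h X

/-- Conversely (negatively): a refutation of the crux refutes the completeness-free version — the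
clause `IsComplete` is NOT load-bearing. -/
theorem not_cruxWithoutComplete_of_not_crux (hn : ¬ HonestFixedRadiusSettling) :
    ¬ ∀ (X : Type) [TopologicalSpace X] [ChartedSpace E3 X] [IsManifold (𝓡 3) ∞ X] [T2Space X]
      [SecondCountableTopology X] [ConnectedSpace X],
      InitialDataSet.IsChristodoulouGeneric
        {D : InitialDataSet (𝓡 3) X | (∀ [D.metric.HasLeviCivita], D.IsVacuumConstraintSolution) ∧
          ∃ (e : AFEnd X) (M : ℝ), e.IsSoleEnd ∧ e.IsStronglyAsymptoticallyFlatDR D M}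
        (· ∈ settlingSet X) 1 := by
  intro h
  apply hn
  rw [crux_iff]
  intro X _ _ _ _ _ _
  rw [admissibleVacuumData_eq_of_t2]
  exact h X

/-- The same for the leaf: the completeness-free version of `stub_core` follows from `stub_core`… -/
theorem coreWithoutComplete_of_core
    (h : ∀ (X : Type) [TopologicalSpace X] [ChartedSpace E3 X] [IsManifold (𝓡 3) ∞ X] [T2Space X]
      [SecondCountableTopology X] [ConnectedSpace X],
      InitialDataSet.IsChristodoulouGeneric (admissibleVacuumData X) (· ∈ coreSet X) 1)
    (X : Type) [TopologicalSpace X] [ChartedSpace E3 X] [IsManifold (𝓡 3) ∞ X] [T2Space X]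
    [SecondCountableTopology X] [ConnectedSpace X] :
    InitialDataSet.IsChristodoulouGeneric
      {D : InitialDataSet (𝓡 3) X | (∀ [D.metric.HasLeviCivita], D.IsVacuumConstraintSolution) ∧
        ∃ (e : AFEnd X) (M : ℝ), e.IsSoleEnd ∧ e.IsStronglyAsymptoticallyFlatDR D M}
      (· ∈ coreSet X) 1 := by
  rw [← admissibleVacuumData_eq_of_t2]
  exact h X

/-- … and a refutation of `stub_core` refutes its completeness-free version. -/
theorem not_coreWithoutComplete_of_not_core
    (hn : ¬ ∀ (X : Type) [TopologicalSpace X] [ChartedSpace E3 X] [IsManifold (𝓡 3) ∞ X] [T2Space X]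
      [SecondCountableTopology X] [ConnectedSpace X],
      InitialDataSet.IsChristodoulouGeneric (admissibleVacuumData X) (· ∈ coreSet X) 1) :
    ¬ ∀ (X : Type) [TopologicalSpace X] [ChartedSpace E3 X] [IsManifold (𝓡 3) ∞ X] [T2Space X]
      [SecondCountableTopology X] [ConnectedSpace X],
      InitialDataSet.IsChristodoulouGeneric
        {D : InitialDataSet (𝓡 3) X | (∀ [D.metric.HasLeviCivita], D.IsVacuumConstraintSolution) ∧
          ∃ (e : AFEnd X) (M : ℝ), e.IsSoleEnd ∧ e.IsStronglyAsymptoticallyFlatDR D M}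
        (· ∈ coreSet X) 1 := by
  intro h
  apply hn
  intro X _ _ _ _ _ _
  rw [admissibleVacuumData_eq_of_t2]
  exact h X

/-! ### §5 The instance hypothesis `[SecondCountableTopology Σ]` is redundant (crux and leaf) -/

/-- The crux implies the same statement for ALL connected Hausdorff smooth `3`-manifolds, second
countable or not: on a manifold carrying an admissible datum the instance is recovered from the
datum's sole end, on the others the admissible class is empty. (The converse is trivial.) -/
theorem cruxWithoutSecondCountable_of_crux (h : HonestFixedRadiusSettling) (X : Type) [TopologicalSpace X]
    [ChartedSpace E3 X] [IsManifold (𝓡 3) ∞ X] [T2Space X] [ConnectedSpace X] :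
    InitialDataSet.IsChristodoulouGeneric (admissibleVacuumData X) (· ∈ settlingSet X) 1 := by
  intro d hd
  haveI := secondCountableTopology_of_mem_admissibleVacuumData hd.1
  exact crux_iff.1 h X d hd

/-- The same for the leaf. -/
theorem coreWithoutSecondCountable_of_core
    (h : ∀ (X : Type) [TopologicalSpace X] [ChartedSpace E3 X] [IsManifold (𝓡 3) ∞ X] [T2Space X]
      [SecondCountableTopology X] [ConnectedSpace X],
      InitialDataSet.IsChristodoulouGeneric (admissibleVacuumData X) (· ∈ coreSet X) 1)
    (X : Type) [TopologicalSpace X] [ChartedSpace E3 X] [IsManifold (𝓡 3) ∞ X] [T2Space X] [ConnectedSpace X] :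
    InitialDataSet.IsChristodoulouGeneric (admissibleVacuumData X) (· ∈ coreSet X) 1 := by
  intro d hd
  haveI := secondCountableTopology_of_mem_admissibleVacuumData hd.1
  exact h X d hd

end Summit.FinalStateConjecture.FinalStateConjecture.Theorems.HonestFixedRadiusSettling.Negative

end
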